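/-
Origin: expansion seat `planner-pub-hodgecm-pv01-0`, handover 2026-08-18T03:44:15Z (`HOME/pub-hodgecm-pv01/lean/Pv01/ReflexWelldef.lean`, md5 737a74a7, 133 lines);
landed by the gen-5 packager in gate run 19 as `HodgeCM/PerL34/ReflexWelldef.lean` (verbatim).
-/
/-
Origin: HOME/pub-hodgecm-pv01/lean/Pv01/ReflexWelldef.lean (module `Pv01.ReflexWelldef`; the packager renames to
`HodgeCM.PerL34.ReflexWelldef`) — session planner-pub-hodgecm-pv01-0 (unit pub-hodgecm-pv01, DAG-NODE PROVER #01).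
DAG node (HOME/LEMMAS.md v2 §1): N02 (PerL v5 §1.4 "Inputs from [Y1neg]", tex ll. 88–113) — SUPPORT: a kernel proof
of one link of the chain behind the input (eq:Na) = [Y1neg] Prop. 6.2, namely [Y1neg] Lemma 6.1
(`inputs/2001/…quadrilinear-period-neg-y1__paper-v2-977557c2.tex` ll. 187–192), which is pure group theory plus the
Galois correspondence.  See HOME/GAPS.md entry `pv01 · N02` for the whole chain and its print leaves.
-/
import Mathlib

set_option autoImplicit false

/-!
# [Y1neg] Lemma 6.1 (an input of PerL v5 (eq:Na)), kernel-checked in abstract form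

[Y1neg] v2 ll. 183–192 (VERBATIM).  Setting (l. 183): "For a CM type `\Phi` of `K` let
`\Stab(\Phi)=\{\sigma:\sigma\Phi=\Phi\}` and `K^*_\Phi:=\ol\Q^{\Stab(\Phi)}`, the reflex field … Given moreover an element
`\varphi^h\in\Phi`, put `A_\Phi:=\{\tau\in\Gal(\ol\Q/\Q):\ \varphi^h\in\tau\Phi\}=\{\tau:\ \tau^{-1}\circ\varphi^h\in\Phi\}`,
`\Phi^*:=\{\tau|_{K^*_\Phi}:\ \tau\in A_\Phi\}`."

Lemma 6.1 (ll. 187–189): "Let `T'\subset\ol\Q` be a number field and suppose the function `\Gal(\ol\Q/\Q)\to\{0,1\}`,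
`\tau\mapsto\mathbf 1_{A_\Phi}(\tau)`, factors through `\tau\mapsto\tau|_{T'}`. Then `T'\supseteq K^*_\Phi`, and the
induced function `p` on `\Hom(T',\ol\Q)` is `p(\lambda)=1\iff\lambda|_{K^*_\Phi}\in\Phi^*`."

Proof (ll. 190–192): "Factoring through `\tau|_{T'}` means `A_\Phi\cdot\Gal(\ol\Q/T')=A_\Phi`. The right stabiliser
`\{u:A_\Phi u=A_\Phi\}` of `A_\Phi=\widetilde\Phi^{-1}` is the inverse of the left stabiliser of
`\widetilde\Phi=\{g:g\varphi^h\in\Phi\}`, and `u\widetilde\Phi=\widetilde\Phi\iff u\Phi=\Phi`; so the right stabiliser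
of `A_\Phi` is exactly `\Stab(\Phi)=\Gal(\ol\Q/K^*_\Phi)`, whence `\Gal(\ol\Q/T')\subseteq\Gal(\ol\Q/K^*_\Phi)`, i.e.
`T'\supseteq K^*_\Phi`. Then `p(\tau|_{T'})=1\iff\tau\in A_\Phi=A_\Phi\Stab(\Phi)\iff\tau|_{K^*_\Phi}\in\Phi^*`."

## Dictionary

* `\Gal(\ol\Q/\Q)` acting on `\Hom(K,\ol\Q)` by composition ↦ a group `G` acting on a type `E` (`MulAction G E`);
  the one property of this action that the proof uses — "`u\widetilde\Phi=\widetilde\Phi\iff u\Phi=\Phi`", i.e.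
  `\widetilde\Phi` determines `\Phi` — holds because the action is TRANSITIVE (any two embeddings of the number field
  `K` into `\ol\Q` differ by an automorphism of `\ol\Q`); transitivity is the hypothesis `MulAction.IsPretransitive G E`
  (standard; labelled).
* `\Phi` ↦ `Φ : Set E`; `\varphi^h` ↦ `φh : E`; `A_\Phi` ↦ `aSet Φ φh := {τ | τ⁻¹ • φh ∈ Φ}`;
  `\Stab(\Phi)` ↦ `MulAction.stabilizer G Φ` (pointwise action on `Set E`);
* "factors through `\tau\mapsto\tau|_{T'}`" ↦ `A_\Phi \cdot H = A_\Phi` for `H = \Gal(\ol\Q/T')`, typed as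
  `∀ h ∈ H, ∀ τ, τ * h ∈ aSet Φ φh ↔ τ ∈ aSet Φ φh` (`l. 190`, first sentence);
* the field step `\Gal(\ol\Q/T')\subseteq\Stab(\Phi) ⇒ T'\supseteq K^*_\Phi` ↦ Mathlib's Galois correspondence for an
  arbitrary Galois extension `Ω/F` (`IntermediateField.fixedField_le`, `InfiniteGalois.fixedField_fixingSubgroup`),
  with `G = Ω ≃ₐ[F] Ω`, `K^*_\Phi := fixedField (stabilizer Φ)`.
* the last clause (`p(\lambda)=1\iff\lambda|_{K^*_\Phi}\in\Phi^*`) is recorded at GROUP level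
  (`mem_aSet_iff_exists_coset`): `τ ∈ A_Φ ⟺ ∃ τ' ∈ A_Φ, τ'⁻¹ τ ∈ Stab(Φ)`, which is its content once restriction to
  `K^*_\Phi` is identified with the coset of `\Stab(\Phi)=\Gal(\ol\Q/K^*_\Phi)` (closed subgroup).

Everything below is KERNEL-PROVED; the only labelled input is transitivity (an instance hypothesis).
-/

open scoped Pointwise

namespace HodgeCM
namespace PerL34
namespace ReflexWelldef

variable {G : Type*} [Group G] {E : Type*} [MulAction G E]

/-- `A_Φ := {τ : τ⁻¹ φ^h ∈ Φ}` ([Y1neg] l. 183). -/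
def aSet (Φ : Set E) (φh : E) : Set G := {τ : G | τ⁻¹ • φh ∈ Φ}

/-- (Ported verbatim from the HodgeCMPerL package; no docstring in the source.) -/
theorem mem_aSet (Φ : Set E) (φh : E) (τ : G) : τ ∈ aSet Φ φh ↔ τ⁻¹ • φh ∈ Φ := Iff.rfl

/-- `A_Φ · Stab(Φ) = A_Φ` (the easy inclusion of l. 191: stabiliser elements are right stabilisers of `A_Φ`). -/
theorem mul_mem_aSet_of_mem_stabilizer (Φ : Set E) (φh : E) {u : G} (hu : u ∈ MulAction.stabilizer G Φ) (τ : G) :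
    τ * u ∈ aSet Φ φh ↔ τ ∈ aSet Φ φh := by
  rw [MulAction.mem_stabilizer_iff] at hu
  simp only [mem_aSet, mul_inv_rev, mul_smul]
  constructor
  · intro h
    have : u • (u⁻¹ • τ⁻¹ • φh) ∈ u • Φ := Set.smul_mem_smul_set h
    rwa [smul_inv_smul, hu] at this
  · intro h
    rw [← hu, Set.mem_smul_set_iff_inv_smul_mem] at h
    exact h

/-- **The right stabiliser of `A_Φ` is `Stab(Φ)`** ([Y1neg] l. 190–191: "the right stabiliser `\{u:A_\Phi u=A_\Phi\}`
of `A_\Phi` … is exactly `\Stab(\Phi)`"), for a TRANSITIVE action. -/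
theorem rightStab_iff [MulAction.IsPretransitive G E] (Φ : Set E) (φh : E) (u : G) :
    (∀ τ : G, τ * u ∈ aSet Φ φh ↔ τ ∈ aSet Φ φh) ↔ u ∈ MulAction.stabilizer G Φ := by
  refine ⟨fun h => ?_, fun hu τ => mul_mem_aSet_of_mem_stabilizer Φ φh hu τ⟩
  rw [MulAction.mem_stabilizer_iff]
  -- every `x : E` is `τ⁻¹ • φh` for some `τ` (transitivity), and `h τ` says `u⁻¹ • x ∈ Φ ↔ x ∈ Φ`
  have key : ∀ x : E, u⁻¹ • x ∈ Φ ↔ x ∈ Φ := by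
    intro x
    obtain ⟨g, hg⟩ := MulAction.exists_smul_eq G φh x
    have := h g⁻¹
    simp only [mem_aSet, mul_inv_rev, inv_inv, mul_smul, hg] at this
    exact this
  ext x
  rw [Set.mem_smul_set_iff_inv_smul_mem]
  exact key x

/-- **[Y1neg] Lemma 6.1, group form**: if `1_{A_Φ}` is right-invariant under a subgroup `H`
("factors through `\tau\mapsto\tau|_{T'}`", `H = \Gal(\ol\Q/T')`), then `H ≤ \Stab(\Phi)` (`= \Gal(\ol\Q/K^*_\Phi)`). -/
theorem le_stabilizer_of_factors [MulAction.IsPretransitive G E] (Φ : Set E) (φh : E) (H : Subgroup G)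
    (hfac : ∀ h ∈ H, ∀ τ : G, τ * h ∈ aSet Φ φh ↔ τ ∈ aSet Φ φh) : H ≤ MulAction.stabilizer G Φ :=
  fun u hu => (rightStab_iff Φ φh u).1 (hfac u hu)

/-- The last clause of [Y1neg] Lemma 6.1 at group level ("`p(\tau|_{T'})=1\iff\tau\in A_\Phi=A_\Phi\Stab(\Phi)\iff
\tau|_{K^*_\Phi}\in\Phi^*`"): membership in `A_Φ` depends only on the left coset `τ·Stab(Φ)`, i.e.
`τ ∈ A_Φ ⟺ ∃ τ' ∈ A_Φ, τ'⁻¹ τ ∈ Stab(Φ)`. -/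
theorem mem_aSet_iff_exists_coset (Φ : Set E) (φh : E) (τ : G) :
    τ ∈ aSet Φ φh ↔ ∃ τ' ∈ aSet Φ φh, τ'⁻¹ * τ ∈ MulAction.stabilizer G Φ := by
  refine ⟨fun h => ⟨τ, h, by simp⟩, ?_⟩
  rintro ⟨τ', hτ', hs⟩
  have := (mul_mem_aSet_of_mem_stabilizer Φ φh hs τ').2 hτ'
  simpa using this

/-! ### The field-theoretic conclusion `T' ⊇ K^*_Φ` -/

section Field

variable {F Ω : Type*} [Field F] [Field Ω] [Algebra F Ω]

/-- **[Y1neg] Lemma 6.1, field form** over an arbitrary Galois extension `Ω/F` (in the paper `\ol\Q/\Q`), with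
`G = Ω ≃ₐ[F] Ω` acting transitively on a type `E` (in the paper `\Hom(K,\ol\Q)`), `K^*_\Phi := Ω^{\Stab(\Phi)}`:
if `1_{A_Φ}` factors through `τ ↦ τ|_{T'}`, i.e. is right-invariant under `\Gal(Ω/T')`, then `K^*_\Phi ≤ T'`. -/
theorem reflexField_le [IsGalois F Ω] {E : Type*} [MulAction (Ω ≃ₐ[F] Ω) E]
    [MulAction.IsPretransitive (Ω ≃ₐ[F] Ω) E] (Φ : Set E) (φh : E) (T' : IntermediateField F Ω)
    (hfac : ∀ h ∈ T'.fixingSubgroup, ∀ τ : Ω ≃ₐ[F] Ω, τ * h ∈ aSet Φ φh ↔ τ ∈ aSet Φ φh) :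
    IntermediateField.fixedField (MulAction.stabilizer (Ω ≃ₐ[F] Ω) Φ) ≤ T' := by
  have hle : T'.fixingSubgroup ≤ MulAction.stabilizer (Ω ≃ₐ[F] Ω) Φ := le_stabilizer_of_factors Φ φh _ hfac
  calc IntermediateField.fixedField (MulAction.stabilizer (Ω ≃ₐ[F] Ω) Φ)
      ≤ IntermediateField.fixedField T'.fixingSubgroup := IntermediateField.fixedField_le hle
    _ = T' := InfiniteGalois.fixedField_fixingSubgroup T'

end Field

end ReflexWelldef
end PerL34
end HodgeCM
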